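import Mathlib

/-!
# Exact inverses FROM APPROXIMATE-INVERSE DATA (the certifiers' `X̃`, `θ`, `δ_X`), part 1:
# abstract front-end, `ℓ²` bookkeeping, unbordered head (Theorem R rows)
(profile-cert-3 g7, cell `ns-blowup`, 2026-08-27)

HONEST FRAMING (human rulings D-0035/D-0074): nothing here is a claim about Navier–Stokes
blow-up. WHAT THIS IS NOT: not NS evidence. MODEL lane bookkeeping about the FORMAT of the F5
certificates (`CertificateAbcResolvent*` non-resonance rows, `CertificateAbcSpectrum*` eigenpair
rows, GROUP A's bracket ends). No certificate, number or census word moves.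
The END-TO-END theorems `ResolventFromSections.resolvent_inverse_of_sections` (p466288),
`BorderedEigenpairFromSections.certified_eigenpair_of_sections_nested` (p465285) and their
`…_of_sections` forms (p471063) posit an EXACT left inverse `Binv` of the (bordered) Galerkin
matrix with certified bounds and a shell inequality whose cross term runs through `Binv`. The
certifier programs (impl-3 `cert3.py` `run_row` 7–12 / `run_resolvent` 3–9; impl-1 `cert.py`
(c4)/(N3)–(N5); impl-2 `i3cert`) certify a FLOAT inverse `X̃`: `θ ≥ ‖I − X̃Â‖₂`, `θ < 1`,
`‖X̃‖ ≤ nX`, `‖X̃[−B·]‖ ≤ yB`, `‖B‖ ≤ nB`, `‖C X̃‖ ≤ yC`, `‖C‖ ≤ nC`, a shell bound `MU2X` for the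
shell matrix built with `X̃`'s block; then `α₀ = nX/(1−θ)`, `δ_X = α₀θ ≥ ‖Â⁻¹ − X̃‖`,
`β_B = yB + nB δ_X`, `β_C = yC + nC δ_X`, `MU2 = MU2X − nB nC δ_X` (Weyl). This file proves that
step (refuter K-NOTE 2, STATUS 2026-08-26T23:56Z «bound the exact inverse, never the float
inverse's own norm»): §1 `exists_inverse_of_approx` — finite-dimensional normed space (any norm),
linear `𝔅`, `X` with `‖y − X(𝔅 y)‖ ≤ θ‖y‖`, `θ < 1` ⇒ TWO-SIDED exact inverse `Binv`,
`(1 − θ)‖Binv y‖ ≤ ‖X y‖`, `‖Binv y − X y‖ ≤ θ‖Binv y‖` (injective ⇒ bijective; no series);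
§2 `ℓ²` bookkeeping (Minkowski, Cauchy–Schwarz, square roots); §3 `exists_headInverse_of_approx`
— the UNBORDERED head `K → 𝕜`: from the `X̃`-data a linear `Binv` with EXACTLY the five matrix
hypotheses `hBinv / hαM / hβBM / hβCM / hshellM` of `resolvent_inverse_of_sections`. Part 2
(`BorderedEigenpairApproxInverse`) = the bordered space; part 3 (`BorderedEigenpairFromApproxInverse`)
= the END-TO-END restatements. Generic (matrix `a`, diagonal `dg`, weights `w`); Mathlib only; no
new definitions. bears_on LADDER-NS N5 / Z4-a(1)(2) (F5 caveat (i) «certifier audit»). [folklore].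
-/

noncomputable section

namespace Summit.NavierStokesRegularity.FluidComputer.CertifierApproxInverse

open Finset
open scoped InnerProductSpace ComplexConjugate

/-! ## §1 The abstract front-end: a contraction residual gives the exact two-sided inverse -/

section Abstract

variable {𝕜 : Type*} [RCLike 𝕜] {V : Type*} [NormedAddCommGroup V] [NormedSpace 𝕜 V]
  [FiniteDimensional 𝕜 V]

/-- **Exact inverse from an approximate inverse.** On a finite-dimensional normed space (ANY norm),
if the linear maps `𝔅` (the matrix) and `X` (its float inverse) satisfy `‖y − X (𝔅 y)‖ ≤ θ ‖y‖`
with `θ < 1`, then `𝔅` has a two-sided linear inverse `Binv` with `(1 − θ) ‖Binv y‖ ≤ ‖X y‖`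
(so `‖Binv‖ ≤ ‖X‖/(1 − θ) = α₀`) and `‖Binv y − X y‖ ≤ θ ‖Binv y‖` (so `‖Binv − X‖ ≤ α₀ θ = δ_X`).
Proof: `X ∘ 𝔅` is injective (a kernel vector `y` has `‖y‖ ≤ θ‖y‖`), hence bijective;
`Binv := (X ∘ 𝔅)⁻¹ ∘ X`; two-sidedness by `mul_eq_one_comm` in the finite-dimensional
endomorphism ring. [folklore] (cert3.py `alpha0`, `deltaX`; cert.py (c4); i3cert) -/
theorem exists_inverse_of_approx (Bo X : V →ₗ[𝕜] V) {θ : ℝ} (hθ1 : θ < 1)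
    (hE : ∀ y, ‖y - X (Bo y)‖ ≤ θ * ‖y‖) :
    ∃ Binv : V →ₗ[𝕜] V, (∀ y, Binv (Bo y) = y) ∧ (∀ y, Bo (Binv y) = y) ∧
      (∀ y, (1 - θ) * ‖Binv y‖ ≤ ‖X y‖) ∧ (∀ y, ‖Binv y - X y‖ ≤ θ * ‖Binv y‖) := by
  set F : V →ₗ[𝕜] V := X ∘ₗ Bo with hF
  have hFinj : Function.Injective F := by
    intro y₁ y₂ h
    have h' : F (y₁ - y₂) = 0 := by rw [map_sub, h, sub_self]
    have hy := hE (y₁ - y₂)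
    rw [show X (Bo (y₁ - y₂)) = F (y₁ - y₂) from rfl, h', sub_zero] at hy
    have h0 : ‖y₁ - y₂‖ ≤ 0 := by
      by_contra hne
      push Not at hne
      nlinarith
    exact sub_eq_zero.mp (norm_le_zero_iff.mp h0)
  have hFbij : Function.Bijective F := ⟨hFinj, LinearMap.surjective_of_injective hFinj⟩
  set G : V ≃ₗ[𝕜] V := LinearEquiv.ofBijective F hFbij with hG
  have hGF : ∀ y, G y = F y := fun y => rfl
  have hGs : ∀ y, G.symm (F y) = y := fun y => by rw [← hGF, LinearEquiv.symm_apply_apply]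
  set Binv : V →ₗ[𝕜] V := (G.symm : V →ₗ[𝕜] V) ∘ₗ X with hBinv
  have h1 : ∀ y, Binv (Bo y) = y := fun y => by
    rw [hBinv, LinearMap.coe_comp, Function.comp_apply, LinearEquiv.coe_coe]
    exact hGs y
  have h2 : ∀ y, Bo (Binv y) = y := by
    have hm : Binv * Bo = 1 := LinearMap.ext h1
    have hm' : Bo * Binv = 1 := mul_eq_one_comm.mp hm
    intro y
    have := LinearMap.congr_fun hm' y
    simpa using this
  refine ⟨Binv, h1, h2, fun y => ?_, fun y => ?_⟩
  · have h4 : ‖Binv y - X y‖ ≤ θ * ‖Binv y‖ := by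
      have := hE (Binv y)
      rwa [h2 y] at this
    have h5 : ‖Binv y‖ ≤ ‖Binv y - X y‖ + ‖X y‖ := by
      have := norm_add_le (Binv y - X y) (X y)
      rwa [sub_add_cancel] at this
    linarith
  · have := hE (Binv y)
    rwa [h2 y] at this

end Abstract

/-! ## §2 `ℓ²` bookkeeping for finitely indexed families -/

section Coord

variable {𝕜 : Type*} [RCLike 𝕜] {ι : Type*}

/-- `‖(u_i)_{i ∈ S}‖² = Σ_{i ∈ S} ‖u_i‖²` in `EuclideanSpace 𝕜 S`. [folklore] -/
theorem norm_toLp_finset_sq (S : Finset ι) (u : ι → 𝕜) :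
    ‖(WithLp.toLp 2 (fun i : S => u i) : EuclideanSpace 𝕜 S)‖ ^ 2 = ∑ i ∈ S, ‖u i‖ ^ 2 := by
  rw [EuclideanSpace.norm_sq_eq]
  exact Finset.sum_coe_sort S (fun i => ‖u i‖ ^ 2)

/-- `‖(u_i)_{i ∈ S}‖ = √(Σ_{i ∈ S} ‖u_i‖²)`. [folklore] -/
theorem norm_toLp_finset (S : Finset ι) (u : ι → 𝕜) :
    ‖(WithLp.toLp 2 (fun i : S => u i) : EuclideanSpace 𝕜 S)‖ = √(∑ i ∈ S, ‖u i‖ ^ 2) := by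
  rw [← norm_toLp_finset_sq, Real.sqrt_sq (norm_nonneg _)]

/-- Minkowski on a finset: `√Σ‖u + w‖² ≤ √Σ‖u‖² + √Σ‖w‖²`. [folklore] -/
theorem sqrt_sum_norm_add_sq_le (S : Finset ι) (u w : ι → 𝕜) :
    √(∑ i ∈ S, ‖u i + w i‖ ^ 2) ≤ √(∑ i ∈ S, ‖u i‖ ^ 2) + √(∑ i ∈ S, ‖w i‖ ^ 2) := by
  have h := norm_add_le (WithLp.toLp 2 (fun i : S => u i) : EuclideanSpace 𝕜 S)
    (WithLp.toLp 2 (fun i : S => w i))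
  rw [← WithLp.toLp_add, norm_toLp_finset, norm_toLp_finset] at h
  rw [← norm_toLp_finset S (fun i => u i + w i)]
  exact h

/-- Scalars pull out: `√Σ‖z u_i‖² = ‖z‖ √Σ‖u_i‖²`. [folklore] -/
theorem sqrt_sum_norm_mul_sq (S : Finset ι) (z : 𝕜) (u : ι → 𝕜) :
    √(∑ i ∈ S, ‖z * u i‖ ^ 2) = ‖z‖ * √(∑ i ∈ S, ‖u i‖ ^ 2) := by
  have h : ∑ i ∈ S, ‖z * u i‖ ^ 2 = ‖z‖ ^ 2 * ∑ i ∈ S, ‖u i‖ ^ 2 := by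
    rw [Finset.mul_sum]
    exact Finset.sum_congr rfl fun i _ => by rw [norm_mul, mul_pow]
  rw [h, Real.sqrt_mul (sq_nonneg _), Real.sqrt_sq (norm_nonneg _)]

/-- Cauchy–Schwarz on a finset, real part: `Re Σ conj(p_i) e_i ≤ √Σ‖p‖² · √Σ‖e‖²`. [folklore] -/
theorem re_sum_conj_mul_le (S : Finset ι) (p e : ι → 𝕜) :
    RCLike.re (∑ i ∈ S, conj (p i) * e i) ≤ √(∑ i ∈ S, ‖p i‖ ^ 2) * √(∑ i ∈ S, ‖e i‖ ^ 2) := by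
  set x : EuclideanSpace 𝕜 S := WithLp.toLp 2 (fun i : S => p i) with hx
  set y : EuclideanSpace 𝕜 S := WithLp.toLp 2 (fun i : S => e i) with hy
  have hinner : ⟪x, y⟫_𝕜 = ∑ i ∈ S, conj (p i) * e i := by
    rw [PiLp.inner_apply, ← Finset.sum_coe_sort S (fun i => conj (p i) * e i)]
    exact Finset.sum_congr rfl fun i _ => by simp [hx, hy, mul_comm]
  rw [← norm_toLp_finset S p, ← norm_toLp_finset S e, ← hinner]
  exact (RCLike.re_le_norm _).trans (norm_inner_le_norm x y)

/-- From a squared bound `A ≤ m² B` (`0 ≤ m`) to `√A ≤ m √B`. -/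
theorem sqrt_le_mul_sqrt {A B m : ℝ} (hm : 0 ≤ m) (h : A ≤ m ^ 2 * B) : √A ≤ m * √B := by
  calc √A ≤ √(m ^ 2 * B) := Real.sqrt_le_sqrt h
    _ = m * √B := by rw [Real.sqrt_mul (sq_nonneg _), Real.sqrt_sq hm]

/-- From `√A ≤ m √B` (`0 ≤ B`) back to `A ≤ m² B`. -/
theorem le_mul_of_sqrt_le {A B m : ℝ} (hA : 0 ≤ A) (hB : 0 ≤ B) (h : √A ≤ m * √B) :
    A ≤ m ^ 2 * B := by
  have := mul_self_le_mul_self (Real.sqrt_nonneg _) h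
  rw [← pow_two, Real.sq_sqrt hA] at this
  calc A ≤ m * √B * (m * √B) := this
    _ = m ^ 2 * (√B) ^ 2 := by ring
    _ = m ^ 2 * B := by rw [Real.sq_sqrt hB]


/-- From a squared bound `‖x‖² ≤ m² B` (`0 ≤ m`) to `‖x‖ ≤ m √B`. -/
theorem norm_le_mul_sqrt {E : Type*} [SeminormedAddCommGroup E] {x : E} {m B : ℝ} (hm : 0 ≤ m)
    (h : ‖x‖ ^ 2 ≤ m ^ 2 * B) : ‖x‖ ≤ m * √B := by
  rw [← Real.sqrt_sq (norm_nonneg x)]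
  exact sqrt_le_mul_sqrt hm h

/-- From `‖x‖ ≤ m √B` (`0 ≤ B`) back to `‖x‖² ≤ m² B`. -/
theorem norm_sq_le_of_le_mul_sqrt {E : Type*} [SeminormedAddCommGroup E] {x : E} {m B : ℝ}
    (hB : 0 ≤ B) (h : ‖x‖ ≤ m * √B) : ‖x‖ ^ 2 ≤ m ^ 2 * B := by
  have h0 : 0 ≤ m * √B := (norm_nonneg _).trans h
  calc ‖x‖ ^ 2 ≤ (m * √B) ^ 2 := pow_le_pow_left₀ (norm_nonneg _) h 2
    _ = m ^ 2 * B := by rw [mul_pow, Real.sq_sqrt hB]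

end Coord

/-! ## §3 The unbordered head (Theorem R rows `CertificateAbcResolvent*`) -/

section Head

variable {𝕜 : Type*} [RCLike 𝕜] {ι : Type*} [DecidableEq ι]

/-- **The unbordered head inverse from approximate-inverse data** (cert3.py `run_resolvent` steps
3–9: `θ, ‖X̃‖ ⇒ α₀ = ‖X̃‖/(1−θ), δ_X = α₀θ, β_B = ‖X̃_K B‖ + ‖B‖δ_X, β_C = ‖C X̃_K‖ + ‖C‖δ_X,
μ = λ_min(shell matrix built with X̃'s block) − ‖B‖‖C‖δ_X`). Setting as in
`exists_borderedInverse_of_approx` without border: Galerkin matrix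
`𝔄 c = (dg_i c_i − Σ_{j∈K} a_ij c_j)_{i∈K}`, float inverse `X` on `K → 𝕜` with, in the `ℓ²` norm,
`‖c − X(𝔄 c)‖ ≤ θ‖c‖` (`θ < 1`), `‖X‖ ≤ nX`, `‖X(−B e)‖ ≤ yB‖e‖_{K_out}`, `‖B e‖ ≤ nB‖e‖_{K_out}`,
`‖C(X c)‖_{Kc} ≤ yC‖c‖`, `‖C z‖_{Kc} ≤ nC‖z‖`, and the shell inequality with constant `MU2X` whose
cross term runs through `X(B e)`. CONCLUSION: a linear `Binv` with the five hypotheses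
`hBinv, hαM, hβBM, hβCM, hshellM` of `ResolventFromSections.resolvent_inverse_of_sections`
LITERALLY (`Kc = K_out` there), constants `α = nX/(1−θ)`, `δ = αθ`, `β_B = yB + nB δ`,
`β_C = yC + nC δ`, `MU2 = MU2X − nB nC δ`. [folklore] -/
theorem exists_headInverse_of_approx
    (K : Finset ι) (nbr : ι → Finset ι) (Kc sh : Finset ι)
    (hKc : K.biUnion nbr \ K ⊆ Kc) (hKsh : K.biUnion nbr \ K ⊆ sh)
    (a : ι → ι → 𝕜) (dg : ι → 𝕜) (w : ι → ℝ)
    (X : (K → 𝕜) →ₗ[𝕜] (K → 𝕜))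
    {θ nX yB nB yC nC MU2X : ℝ}
    (hθ0 : 0 ≤ θ) (hθ1 : θ < 1) (hnX0 : 0 ≤ nX) (hyB0 : 0 ≤ yB) (hnB0 : 0 ≤ nB)
    (hyC0 : 0 ≤ yC) (hnC0 : 0 ≤ nC)
    (hθ : ∀ c : K → 𝕜,
      ∑ j : K, ‖c j - X (fun i : K => dg i * c i - ∑ j : K, a i j * c j) j‖ ^ 2 ≤
        θ ^ 2 * ∑ j : K, ‖c j‖ ^ 2)
    (hnX : ∀ c : K → 𝕜, ∑ j : K, ‖X c j‖ ^ 2 ≤ nX ^ 2 * ∑ j : K, ‖c j‖ ^ 2)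
    (hyB : ∀ e : ι → 𝕜,
      ∑ j : K, ‖X (fun i : K => -∑ j ∈ nbr i \ K, a i j * e j) j‖ ^ 2 ≤
        yB ^ 2 * ∑ j ∈ K.biUnion nbr \ K, ‖e j‖ ^ 2)
    (hnB : ∀ e : ι → 𝕜,
      ∑ i : K, ‖∑ j ∈ nbr i \ K, a i j * e j‖ ^ 2 ≤ nB ^ 2 * ∑ j ∈ K.biUnion nbr \ K, ‖e j‖ ^ 2)
    (hyC : ∀ c : K → 𝕜,
      ∑ i ∈ Kc, ‖∑ j : K, a i j * X c j‖ ^ 2 ≤ yC ^ 2 * ∑ j : K, ‖c j‖ ^ 2)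
    (hnC : ∀ z : K → 𝕜, ∑ i ∈ Kc, ‖∑ j : K, a i j * z j‖ ^ 2 ≤ nC ^ 2 * ∑ j : K, ‖z j‖ ^ 2)
    (hshellX : ∀ e : ι → 𝕜, (∀ i ∈ K, e i = 0) →
      MU2X * ∑ i ∈ sh, ‖e i‖ ^ 2 ≤ ∑ i ∈ sh, w i * ‖e i‖ ^ 2 -
        RCLike.re (∑ i ∈ K.biUnion nbr \ K,
          conj (∑ j : K, a i j * X (fun i : K => ∑ j ∈ nbr i \ K, a i j * e j) j) * e i))
    {α δ βB βC MU2 : ℝ} (hαdef : α = nX / (1 - θ)) (hδdef : δ = α * θ)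
    (hβBdef : βB = yB + nB * δ) (hβCdef : βC = yC + nC * δ)
    (hMU2def : MU2 = MU2X - nB * nC * δ) :
    ∃ Binv : (K → 𝕜) →ₗ[𝕜] (K → 𝕜),
      (∀ c : K → 𝕜, Binv (fun i : K => dg i * c i - ∑ j : K, a i j * c j) = c) ∧
      (∀ c : K → 𝕜, ∑ j : K, ‖Binv c j‖ ^ 2 ≤ α ^ 2 * ∑ i : K, ‖c i‖ ^ 2) ∧
      (∀ e : ι → 𝕜, ∑ j : K, ‖Binv (fun i : K => -∑ j ∈ nbr i \ K, a i j * e j) j‖ ^ 2 ≤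
        βB ^ 2 * ∑ j ∈ K.biUnion nbr \ K, ‖e j‖ ^ 2) ∧
      (∀ c : K → 𝕜, ∑ i ∈ Kc, ‖∑ j : K, a i j * Binv c j‖ ^ 2 ≤ βC ^ 2 * ∑ i : K, ‖c i‖ ^ 2) ∧
      (∀ e : ι → 𝕜, (∀ i ∈ K, e i = 0) →
        MU2 * ∑ i ∈ sh, ‖e i‖ ^ 2 ≤ ∑ i ∈ sh, w i * ‖e i‖ ^ 2 -
          RCLike.re (∑ i ∈ K.biUnion nbr \ K,
            conj (∑ j : K, a i j * Binv (fun i : K => ∑ j ∈ nbr i \ K, a i j * e j) j) * e i)) := by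
  -- the transport maps to `V = EuclideanSpace 𝕜 K`
  let toV : (K → 𝕜) →ₗ[𝕜] EuclideanSpace 𝕜 K :=
    { toFun := fun c => WithLp.toLp 2 c
      map_add' := fun _ _ => rfl
      map_smul' := fun _ _ => rfl }
  let ofV : EuclideanSpace 𝕜 K →ₗ[𝕜] (K → 𝕜) :=
    { toFun := fun v => WithLp.ofLp v
      map_add' := fun _ _ => rfl
      map_smul' := fun _ _ => rfl }
  have h_ot : ∀ c, ofV (toV c) = c := fun _ => rfl
  have h_to : ∀ v, toV (ofV v) = v := fun _ => rfl
  have hN2 : ∀ c : K → 𝕜, ‖toV c‖ ^ 2 = ∑ j : K, ‖c j‖ ^ 2 := fun c => EuclideanSpace.norm_sq_eq _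
  have hN : ∀ c : K → 𝕜, ‖toV c‖ = √(∑ j : K, ‖c j‖ ^ 2) := fun c => EuclideanSpace.norm_eq _
  -- the Galerkin matrix as a linear map
  let Bo : (K → 𝕜) →ₗ[𝕜] (K → 𝕜) :=
    { toFun := fun c => fun i : K => dg i * c i - ∑ j : K, a i j * c j
      map_add' := fun y z => by
        funext i
        simp only [Pi.add_apply, mul_add, Finset.sum_add_distrib]
        ring
      map_smul' := fun r y => by
        funext i
        simp only [Pi.smul_apply, smul_eq_mul, RingHom.id_apply]
        have hs : ∑ j : K, a i j * (r * y j) = r * ∑ j : K, a i j * y j := by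
          rw [Finset.mul_sum]; exact Finset.sum_congr rfl fun j _ => by ring
        rw [hs]; ring }
  obtain ⟨Binv', h1, h2, h3, h4⟩ := exists_inverse_of_approx (𝕜 := 𝕜)
    (toV ∘ₗ Bo ∘ₗ ofV) (toV ∘ₗ X ∘ₗ ofV) hθ1 (fun v => by
      set y := ofV v with hy
      have hv : v = toV y := (h_to v).symm
      have key : v - (toV ∘ₗ X ∘ₗ ofV) ((toV ∘ₗ Bo ∘ₗ ofV) v) = toV (y - X (Bo y)) := by
        rw [map_sub, ← hv]
        simp only [LinearMap.coe_comp, Function.comp_apply, ← hy, h_ot]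
      rw [key, hv, hN, hN]
      exact sqrt_le_mul_sqrt hθ0 (hθ y))
  set Binv : (K → 𝕜) →ₗ[𝕜] (K → 𝕜) := ofV ∘ₗ Binv' ∘ₗ toV with hBinv_def
  have hBapp : ∀ y, Binv y = ofV (Binv' (toV y)) := fun y => rfl
  have htoVB : ∀ y, toV (Binv y) = Binv' (toV y) := fun y => by rw [hBapp, h_to]
  have hX' : ∀ y, (toV ∘ₗ X ∘ₗ ofV) (toV y) = toV (X y) := fun y => by
    simp only [LinearMap.coe_comp, Function.comp_apply, h_ot]
  have hnX' : ∀ y, ‖toV (X y)‖ ≤ nX * ‖toV y‖ := fun y => by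
    rw [hN, hN]; exact sqrt_le_mul_sqrt hnX0 (hnX y)
  have h1θ : 0 < 1 - θ := by linarith
  have hαB : ∀ y, ‖toV (Binv y)‖ ≤ α * ‖toV y‖ := fun y => by
    have h := h3 (toV y)
    rw [hX', ← htoVB] at h
    rw [hαdef, div_mul_eq_mul_div, le_div_iff₀ h1θ]
    calc ‖toV (Binv y)‖ * (1 - θ) = (1 - θ) * ‖toV (Binv y)‖ := mul_comm _ _
      _ ≤ ‖toV (X y)‖ := h
      _ ≤ nX * ‖toV y‖ := hnX' y
  have hα0 : 0 ≤ α := by rw [hαdef]; positivity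
  have hδB : ∀ y, ‖toV (Binv y - X y)‖ ≤ δ * ‖toV y‖ := fun y => by
    have h := h4 (toV y)
    rw [hX', ← htoVB, ← map_sub] at h
    rw [hδdef]
    calc ‖toV (Binv y - X y)‖ ≤ θ * ‖toV (Binv y)‖ := h
      _ ≤ θ * (α * ‖toV y‖) := mul_le_mul_of_nonneg_left (hαB y) hθ0
      _ = α * θ * ‖toV y‖ := by ring
  have hδ0 : 0 ≤ δ := by rw [hδdef]; positivity
  have hBe : ∀ e : ι → 𝕜,
      ‖toV (fun i : K => ∑ j ∈ nbr i \ K, a i j * e j)‖ ≤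
        nB * √(∑ j ∈ K.biUnion nbr \ K, ‖e j‖ ^ 2) := fun e =>
    norm_le_mul_sqrt hnB0 (by rw [hN2]; exact hnB e)
  have hBe' : ∀ e : ι → 𝕜,
      ‖toV (fun i : K => -∑ j ∈ nbr i \ K, a i j * e j)‖ ≤
        nB * √(∑ j ∈ K.biUnion nbr \ K, ‖e j‖ ^ 2) := fun e =>
    norm_le_mul_sqrt hnB0 (by rw [hN2]; simpa using hnB e)
  refine ⟨Binv, fun c => ?_, fun c => ?_, fun e => ?_, fun c => ?_, fun e he => ?_⟩
  · -- left inverse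
    have h := h1 (toV c)
    simp only [LinearMap.coe_comp, Function.comp_apply, h_ot] at h
    have : Binv (Bo c) = c := by rw [hBapp, h, h_ot]
    exact this
  · -- `α`
    have h := hαB c
    rw [hN c] at h
    have h2 := norm_sq_le_of_le_mul_sqrt (B := ∑ i : K, ‖c i‖ ^ 2) (by positivity) h
    rw [hN2] at h2
    exact h2
  · -- `β_B`
    set y : K → 𝕜 := fun i : K => -∑ j ∈ nbr i \ K, a i j * e j with hy
    set E := ∑ j ∈ K.biUnion nbr \ K, ‖e j‖ ^ 2 with hE
    have hE0 : 0 ≤ E := Finset.sum_nonneg fun _ _ => sq_nonneg _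
    have hXy : ‖toV (X y)‖ ≤ yB * √E := norm_le_mul_sqrt hyB0 (by rw [hN2]; exact hyB e)
    have hmain : ‖toV (Binv y)‖ ≤ βB * √E := by
      have hsplit : toV (Binv y) = toV (X y) + toV (Binv y - X y) := by
        rw [← map_add, add_sub_cancel]
      calc ‖toV (Binv y)‖ ≤ ‖toV (X y)‖ + ‖toV (Binv y - X y)‖ := by
            rw [hsplit]; exact norm_add_le _ _
        _ ≤ yB * √E + δ * ‖toV y‖ := add_le_add hXy (hδB y)
        _ ≤ yB * √E + δ * (nB * √E) := by gcongr; exact hBe' e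
        _ = βB * √E := by rw [hβBdef]; ring
    rw [← hN2]
    exact norm_sq_le_of_le_mul_sqrt hE0 hmain
  · -- `β_C`
    set b := Binv c with hb
    set x := X c with hx
    set N2 := ∑ i : K, ‖c i‖ ^ 2 with hN2def
    have hN20 : 0 ≤ N2 := by positivity
    have hNy : ‖toV c‖ = √N2 := by rw [hN]
    have hbx : ‖toV (b - x)‖ ≤ δ * √N2 := by rw [← hNy]; exact hδB c
    have hCx : √(∑ i ∈ Kc, ‖∑ j : K, a i j * x j‖ ^ 2) ≤ yC * √N2 :=
      sqrt_le_mul_sqrt hyC0 (hyC c)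
    have hd1 : √(∑ j : K, ‖b j - x j‖ ^ 2) = ‖toV (b - x)‖ := by rw [hN]; rfl
    have hCd : √(∑ i ∈ Kc, ‖∑ j : K, a i j * (b j - x j)‖ ^ 2) ≤ nC * (δ * √N2) :=
      (sqrt_le_mul_sqrt hnC0 (hnC fun j => b j - x j)).trans
        (mul_le_mul_of_nonneg_left (hd1.trans_le hbx) hnC0)
    have hCsplit : ∀ i, ∑ j : K, a i j * b j =
        ∑ j : K, a i j * x j + ∑ j : K, a i j * (b j - x j) := fun i => by
      rw [← Finset.sum_add_distrib]; exact Finset.sum_congr rfl fun j _ => by ring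
    have htot : √(∑ i ∈ Kc, ‖∑ j : K, a i j * b j‖ ^ 2) ≤ βC * √N2 := by
      calc √(∑ i ∈ Kc, ‖∑ j : K, a i j * b j‖ ^ 2)
          = √(∑ i ∈ Kc, ‖∑ j : K, a i j * x j + ∑ j : K, a i j * (b j - x j)‖ ^ 2) := by
            simp_rw [hCsplit]
        _ ≤ _ := sqrt_sum_norm_add_sq_le Kc _ _
        _ ≤ yC * √N2 + nC * (δ * √N2) := add_le_add hCx hCd
        _ = βC * √N2 := by rw [hβCdef]; ring
    exact le_mul_of_sqrt_le (by positivity) hN20 htot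
  · -- the shell inequality through `Binv`
    set y : K → 𝕜 := fun i : K => ∑ j ∈ nbr i \ K, a i j * e j with hy
    set E := ∑ j ∈ K.biUnion nbr \ K, ‖e j‖ ^ 2 with hE
    set Ssh := ∑ i ∈ sh, ‖e i‖ ^ 2 with hSsh
    have hE0 : 0 ≤ E := Finset.sum_nonneg fun _ _ => sq_nonneg _
    have hES : E ≤ Ssh :=
      Finset.sum_le_sum_of_subset_of_nonneg hKsh fun _ _ _ => sq_nonneg _
    set D := Binv y - X y with hD
    have hCsplit : ∀ i, ∑ j : K, a i j * Binv y j =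
        ∑ j : K, a i j * X y j + ∑ j : K, a i j * D j := fun i => by
      rw [← Finset.sum_add_distrib]
      exact Finset.sum_congr rfl fun j _ => by rw [hD, Pi.sub_apply]; ring
    have hsum : ∑ i ∈ K.biUnion nbr \ K, conj (∑ j : K, a i j * Binv y j) * e i =
        ∑ i ∈ K.biUnion nbr \ K, conj (∑ j : K, a i j * X y j) * e i +
          ∑ i ∈ K.biUnion nbr \ K, conj (∑ j : K, a i j * D j) * e i := by
      rw [← Finset.sum_add_distrib]
      exact Finset.sum_congr rfl fun i _ => by rw [hCsplit, map_add, add_mul]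
    have hcross : RCLike.re (∑ i ∈ K.biUnion nbr \ K, conj (∑ j : K, a i j * D j) * e i) ≤
        nB * nC * δ * Ssh := by
      have h1 := re_sum_conj_mul_le (K.biUnion nbr \ K) (fun i => ∑ j : K, a i j * D j) e
      have h2 : √(∑ i ∈ K.biUnion nbr \ K, ‖∑ j : K, a i j * D j‖ ^ 2) ≤
          nC * (δ * (nB * √E)) := by
        calc √(∑ i ∈ K.biUnion nbr \ K, ‖∑ j : K, a i j * D j‖ ^ 2)
            ≤ √(∑ i ∈ Kc, ‖∑ j : K, a i j * D j‖ ^ 2) := Real.sqrt_le_sqrt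
              (Finset.sum_le_sum_of_subset_of_nonneg hKc fun _ _ _ => sq_nonneg _)
          _ ≤ nC * √(∑ j : K, ‖D j‖ ^ 2) := sqrt_le_mul_sqrt hnC0 (hnC D)
          _ = nC * ‖toV D‖ := by rw [hN]
          _ ≤ nC * (δ * ‖toV y‖) := mul_le_mul_of_nonneg_left (hδB y) hnC0
          _ ≤ nC * (δ * (nB * √E)) := by gcongr; exact hBe e
      calc RCLike.re (∑ i ∈ K.biUnion nbr \ K, conj (∑ j : K, a i j * D j) * e i)
          ≤ √(∑ i ∈ K.biUnion nbr \ K, ‖∑ j : K, a i j * D j‖ ^ 2) * √E := h1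
        _ ≤ nC * (δ * (nB * √E)) * √E := by gcongr
        _ = nB * nC * δ * (√E * √E) := by ring
        _ = nB * nC * δ * E := by rw [Real.mul_self_sqrt hE0]
        _ ≤ nB * nC * δ * Ssh := by gcongr
    have hX := hshellX e he
    rw [hsum, map_add, hMU2def, sub_mul]
    linarith

end Head

end Summit.NavierStokesRegularity.FluidComputer.CertifierApproxInverse

end
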